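import Mathlib
import HarnessLib
import Summits.Langlands.Langlands.Theses.K3SpinSixteen
import Literature.NumberTheory.GaloisRepresentations.CrystallineOrdinary
import Literature.NumberTheory.Automorphic.InfinityType

/-!
# Birth skeleton (BC3) for crux stmt-Langlands-12825
`Summit.Langlands.Langlands.Theses.K3SpinSixteen.OrthogonalK3Lifting` — line `birth`

Route `route-Langlands-K3SpinSixteen` (rank-2 crux; no `Disproof.lean`, no `Negative/` lemma, no earlier
line on file for this crux, `ledger crux ls stmt-Langlands-12825` 2026-08-17).

The crux is ORTHOGONAL K3-TYPE AUTOMORPHY LIFTING OVER `ℚ` at the doubly-singular K3 weight: for `E`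
imaginary quadratic, `τ ∉ res Γ_E`, `p ≠ 2` split in `E`, and `r, r' : Γ_ℚ → GL₆(ℚ̄_p)` both exactly
orthogonal, odd sector (`det = η_E`), K3-ordinary of shape `(1,4,1)` at `p`, unramified a.e., with
`r̄|Γ_{E(ζ_p)}` absolutely irreducible (Burnside form), `r ≡ r'` residually and `r'` Satake-matching an
L-algebraic cuspidal `π'` of `GL₆(𝔸_ℚ)` a.e. ⟹ `r` Satake-matches some L-algebraic cuspidal `π` a.e.

The intended engine (route header: spin avatars on `GU_E(2,2) ⊃ Spin(V₀)`, higher Hida theory of the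
`U(2,2)/SO(4,2)` fourfold, Calegari–Geraghty patching in defect `ℓ₀ = 2`, Arthur's transfer
`SO(V₀) → GL₆/ℚ`) lives on groups the tree cannot name (the summit is `GL_n`-only; no `AdelicGroupData`
instance for `SO(V₀)` / `GSpin(V₀)`), so this skeleton cuts the crux along the one interface that IS
`GL₆/ℚ`-typeable and that every ordinary (higher-)Hida-family argument passes through: a REGULAR-WEIGHT
ORDINARY AUTOMORPHIC CONGRUENT COMPANION `r''` of the automorphic K3 point `(r', π')`.

* `stub_residualBignessTransport` — **Brauer–Nesbitt transport of the big-image hypothesis along the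
  congruence** (the crux puts absolute irreducibility of the reduction on `r`, the family is anchored at
  `r'`): `r ≡ r'` residually and `r̄|Γ_L` absolutely irreducible (Burnside form,
  `FramedRep.HasAbsolutelyIrreducibleReduction`) ⟹ `r̄'|Γ_L` absolutely irreducible. Integral models
  (`exists_integralModel`, compact `Γ_L`), `isResiduallyCongruent_iff_charpoly_residualRep_eq`, then
  Brauer–Nesbitt over `𝔽̄_p` (NOT in the tree — the module docstring of `AbsolutelyIrreducibleReduction`
  says so) and "semisimplification irreducible ⟹ irreducible", back to Burnside form
  (`hasAbsolutelyIrreducibleReduction_iff_exists_span_eq_top`). Size M–L, provable now.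
* `stub_regularOrdinaryCompanion` — **the automorphic K3 point lies on an ordinary family with a
  classical REGULAR point** (higher Hida theory, vertical direction): from `(r', π')` as in the crux
  (exactly orthogonal, odd sector, K3-ordinary at `p`, unramified a.e., residually big over `E(ζ_p)`,
  `π'` L-algebraic cuspidal Satake-matching `r'` a.e.) produce `r'' : Γ_ℚ → GL₆(ℚ̄_p)` exactly orthogonal,
  odd sector, CRYSTALLINE-ORDINARY WITH DISTINCT EXPONENTS at `p` (tree notion
  `FramedGaloisRep.IsCrystallineOrdinaryAt`, Greenberg/Thorne), unramified a.e., `r' ≡ r''` residually,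
  Satake-matching a.e. a cuspidal `π''` of `GL₆(𝔸_ℚ)` whose infinity type is L-algebraic AND REGULAR.
  Content: descent of `π'` to the quasi-split `SO(V₀) = SO(4,2)^E` / `GSpin(V₀)` (Arthur 2013 Thm 1.5.2
  backwards: `π' ≅ π'^∨` by strong multiplicity one since `r' ≅ r'^∨`; orthogonal type; discriminant
  character `η_E = det r'`), `π'_∞` in the non-degenerate-limit packet of the K3 weight (this needs the
  infinitesimal character of `π'_∞` to be the K3 one — NOT among the crux's hypotheses, which only say
  `IsLAlgebraic`: a genuine gap of the crux as typed, located HERE), `U_p`-ordinarity of the descended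
  form from K3-ordinarity of `r'` (local–global compatibility at `p` for Goldring–Koskivirta
  representations), the ordinary family through it (integral higher Hida theory of the 4-fold at a weight
  on two walls: not in print), a classical regular specialisation congruent mod `p` (fails exactly if the
  K3 eigensystem is wall-supported `Λ`-torsion), its Galois representation (Shin/CHT through Arthur's
  transfer, orthogonal by Bellaïche–Chenevier, `det = η_E`) and cuspidality of its transfer (from the big
  residual image). Size XL.
* `stub_liftFromRegularCompanion` — **singular-weight ordinary lifting from a regular automorphic
  congruence** (the BCGP-shaped theorem one rung down, `GSp₄ ↦ SO(4,2)^E`): `r` as in the crux and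
  `r''` as produced above with `r ≡ r''` ⟹ `r` Satake-matches an L-algebraic cuspidal `π` a.e.
  Content: Hida family through `π''`, Calegari–Geraghty/BCGP patching of the ordinary higher-Hida complex
  (perfect of amplitude ≤ 2, defect `ℓ₀ = 2`) with the orthogonal/similitude Hecke algebra at inert
  primes, adequacy of `r̄(Γ_{E(ζ_p)})` (Thorne: automatic for `p ≥ 2(4+1)`; `p ∈ {3,5,7}` allowed by
  the crux — refuter sharpening recorded on the item), `p`-distinguishedness of the `(1,4,1)` flag,
  classicity of the singular-weight ordinary specialisation (Pilloni-type theorem at the K3 weight), and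
  Arthur's transfer `SO(V₀) → GL₆/ℚ` with unramified matching at split AND inert places. Size XL — the
  hardest stub; `NonRegularWeightBarrier`, `TaylorWilesNumericalCoincidence(Narrow)` and
  `PatchingLocalComponentBarrier` are engaged here exactly as in the route header.
* `OrthogonalK3Lifting_of` — **the composition, kernel-checked (no `sorry`)**: transport the big image
  from `r` to `r'` along `r ≡ r'` (`CyclotomicField p E`), take the regular companion `(r'', π'')` of
  `(r', π')`, chain the congruences `r ≡ r' ≡ r''` (`FramedRep.IsResiduallyCongruent.trans`, ultrametric
  `ℚ̄_p`), and lift. Concludes the route decl BY NAME.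

Honest reading of the cut: the detour through a regular point is the standard shape of ordinary
lifting theorems ("`ρ̄ ≅ ρ̄_π` for an ordinary `π` of regular weight") and isolates the two places where
the K3 weight bites — putting the singular automorphic INPUT into the family (`stub_regularOrdinaryCompanion`)
and getting a classical singular OUTPUT out of `R^ord = T^ord` (`stub_liftFromRegularCompanion`). Both big
stubs are consequences of `Langlands`-world expectations (each conclusion is an instance of reciprocity or
of the existence of ordinary families), neither is the crux (the first concludes about `r''`, the second
needs a REGULAR companion the crux does not supply), and neither is refuted by anything on file.

Disproof used: none on file for this crux (no `Disproof.lean`, no `Negative/`, 2026-08-17).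

Shape (for `ledger skeleton check`): stubs `theorem stub_<name> : <signature> := by sorry` stated over tree
declarations only (route-file vocabulary verbatim + `FramedGaloisRep.IsCrystallineOrdinaryAt`,
`InfinityType.IsLAlgebraic/IsRegular`, `AutomorphicRepData.HasInfinityType`);
`_Goal.stub_<name> : Prop := type_of% @stub_<name>` names each statement; the composition
`OrthogonalK3Lifting_of (h₁ : _Goal.stub_residualBignessTransport) (h₂ : _Goal.stub_regularOrdinaryCompanion)
(h₃ : _Goal.stub_liftFromRegularCompanion) : OrthogonalK3Lifting` is proved without `sorry`.
-/

set_option linter.dupNamespace false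
set_option linter.unusedVariables false

noncomputable section

namespace Summit.Langlands.Langlands.Cruxes.OrthogonalK3Lifting.Birth

open Summit.Langlands Summit.Langlands.Langlands.Theses.K3SpinSixteen
open Literature.NumberTheory.GaloisRepresentations Literature.NumberTheory.Automorphic
open scoped Matrix NumberField

/-! ## 1. The three stubs -/

/-- **STUB 1 — Brauer–Nesbitt transport of absolute irreducibility of the reduction along a residual
congruence.** For framed `r, r' : Γ_K → GL_n(ℚ̄_p)` with coefficientwise congruent characteristic
polynomials (`FramedRep.IsResiduallyCongruent`) and an extension `L/K`: if `r|Γ_L` has absolutely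
irreducible reduction in Burnside form (`FramedRep.HasAbsolutelyIrreducibleReduction`), so does `r'|Γ_L`.
Proof sketch: integral models of both restrictions (compactness of `Γ_L`), equal characteristic
polynomials of the reductions (`isResiduallyCongruent_iff_charpoly_residualRep_eq`), Brauer–Nesbitt over
the algebraically closed residue field `𝔽̄_p` gives `r̄'ˢˢ ≅ r̄`, irreducible, hence `r̄'` irreducible and
absolutely so, hence Burnside spanning (`hasAbsolutelyIrreducibleReduction_iff_exists_span_eq_top`).
Size M–L (Brauer–Nesbitt is not in the tree). Needed because the crux types the big-image hypothesis on
`r` while the ordinary family is anchored at the automorphic `r'`.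
[cite: CurtisReiner1962, (27.4) and (30.16)] [cite: Thorne2012, §2] -/
theorem stub_residualBignessTransport :
    ∀ (p : ℕ) [Fact p.Prime] (n : ℕ) (K : Type) [Field K] (L : Type) [Field L] [Algebra K L]
      (r r' : Literature.NumberTheory.GaloisRepresentations.FramedGaloisRep K (PadicAlgCl p) n),
      r.IsResiduallyCongruent r' →
      (r.restrictField L).HasAbsolutelyIrreducibleReduction →
      (r'.restrictField L).HasAbsolutelyIrreducibleReduction := by
  sorry

/-- **STUB 2 — the automorphic K3 point lies on an ordinary family with a classical regular point.**
For `E, τ, p` (odd, split in `E`), `ι`, and `r' : Γ_ℚ → GL₆(ℚ̄_p)` exactly orthogonal, odd sector,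
K3-ordinary of shape `(1,4,1)` at `p`, unramified a.e., residually absolutely irreducible on `Γ_{E(ζ_p)}`,
Satake-matching a.e. an L-algebraic cuspidal `π'` of `GL₆(𝔸_ℚ)`: there is `r'' : Γ_ℚ → GL₆(ℚ̄_p)`,
exactly orthogonal, odd sector, crystalline-ordinary with DISTINCT cyclotomic exponents at `p`
(`FramedGaloisRep.IsCrystallineOrdinaryAt`), unramified a.e., residually congruent to `r'`, and
Satake-matching a.e. a cuspidal `π''` of `GL₆(𝔸_ℚ)` with an L-algebraic REGULAR infinity type.
Route of proof: descend `π'` to `SO(V₀) = SO(4,2)^E` (Arthur; `π'` self-dual of orthogonal type with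
discriminant character `det r' = η_E`), place it in the ordinary higher-Hida family of the
`GSpin(V₀) ~ GU_E(2,2)` Shimura fourfold at the K3 weight (needs: `π'_∞` of K3 infinitesimal character —
not supplied by the crux's `IsLAlgebraic`; `U_p`-ordinarity from K3-ordinarity of `r'`; integral higher
Hida theory on two walls), specialise at a regular classical weight in the same maximal ideal (fails iff
the K3 eigensystem is wall-supported `Λ`-torsion), attach `r''` (Arthur transfer to `GL₆` + Shin/CHT;
orthogonal with `det = η_E`; ordinary by the family; cuspidal transfer by the big residual image).
Size XL. Why it might fail: no higher Hida theory for this fourfold in print; the infinity type of `π'`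
is unconstrained by the crux. Implied by the expected shape of ordinary families (and by reciprocity for
the existence of SOME regular automorphic orthogonal lift of `r̄'`).
[cite: Pilloni2020, Thm 1.1] [cite: BoxerEtAl2021, §4–§6, Thm 8.4.1] [cite: GoldringKoskivirta2019, Thm 3.5.5]
[cite: Arthur2013, Thm 1.5.2] -/
theorem stub_regularOrdinaryCompanion :
    ∀ (E : Type) [Field E] [NumberField E] [IsGalois ℚ E] [NumberField.IsTotallyComplex E],
      Module.finrank ℚ E = 2 →
    ∀ (τ : Field.absoluteGaloisGroup ℚ),
      τ ∉ Set.range (Literature.NumberTheory.GaloisRepresentations.absGaloisRestrict ℚ E) →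
    ∀ (p : ℕ) [Fact p.Prime], p ≠ 2 →
    (∃ w w' : IsDedekindDomain.HeightOneSpectrum (NumberField.RingOfIntegers E), w ≠ w' ∧
      ((p : ℕ) : NumberField.RingOfIntegers E) ∈ w.asIdeal ∧
      ((p : ℕ) : NumberField.RingOfIntegers E) ∈ w'.asIdeal) →
    ∀ (ι : PadicAlgCl p ≃+* ℂ)
      (hcpt : Literature.NumberTheory.Automorphic.isCompact_glFiniteIntegralLevel 6 ℚ)
      (r' : Literature.NumberTheory.GaloisRepresentations.FramedGaloisRep ℚ (PadicAlgCl p) 6),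
      (∃ J : Matrix (Fin 6) (Fin 6) (PadicAlgCl p), J.IsSymm ∧ IsUnit J ∧
        ∀ σ, (r' σ).valᵀ * J * (r' σ).val = J) →
      ((∀ σ, (r'.restrictField E).det σ = 1) ∧ r'.det τ = -1) →
      (∀ (v : IsDedekindDomain.HeightOneSpectrum (NumberField.RingOfIntegers ℚ)),
        ((p : ℕ) : NumberField.RingOfIntegers ℚ) ∈ v.asIdeal →
        ∃ (g : GL (Fin 6) (PadicAlgCl p))
          (U : OpenSubgroup (Field.absoluteGaloisGroup (v.adicCompletion ℚ))),
          (∀ σ (i j : Fin 6), ((1 ≤ i.val ∧ j.val = 0) ∨ (i.val = 5 ∧ j.val ≤ 4)) →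
            (g * r'.toLocal v σ * g⁻¹).val i j = 0) ∧
          (∀ σ ∈ Literature.NumberTheory.GaloisRepresentations.absInertia (v.adicCompletion ℚ),
            σ ∈ U →
            (∀ i j : Fin 6, (1 ≤ i.val ∧ i.val ≤ 4 ∧ 1 ≤ j.val ∧ j.val ≤ 4) →
              (g * r'.toLocal v σ * g⁻¹).val i j = if i = j then 1 else 0) ∧
            (g * r'.toLocal v σ * g⁻¹).val 0 0 = algebraMap ℚ_[p] (PadicAlgCl p)
              ((Literature.NumberTheory.GaloisRepresentations.GaloisRep.cyclotomicCharacter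
                (v.adicCompletion ℚ) p σ : ℤ_[p]ˣ) : ℤ_[p]) ∧
            (g * r'.toLocal v σ * g⁻¹).val 0 0 * (g * r'.toLocal v σ * g⁻¹).val 5 5 = 1)) →
      (∀ᶠ v in Filter.cofinite, r'.IsUnramifiedAt v) →
      (r'.restrictField (CyclotomicField p E)).HasAbsolutelyIrreducibleReduction →
      (∃ π' : Literature.NumberTheory.Automorphic.CuspidalAutomorphicRepData 6 ℚ hcpt,
        π'.1.IsLAlgebraic ∧ ∀ᶠ v in Filter.cofinite, SatakeFrobCompatibleAt ι π'.1 r' v) →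
      ∃ r'' : Literature.NumberTheory.GaloisRepresentations.FramedGaloisRep ℚ (PadicAlgCl p) 6,
      (∃ J : Matrix (Fin 6) (Fin 6) (PadicAlgCl p), J.IsSymm ∧ IsUnit J ∧
        ∀ σ, (r'' σ).valᵀ * J * (r'' σ).val = J) ∧
      ((∀ σ, (r''.restrictField E).det σ = 1) ∧ r''.det τ = -1) ∧
      (∀ (v : IsDedekindDomain.HeightOneSpectrum (NumberField.RingOfIntegers ℚ)),
        ((p : ℕ) : NumberField.RingOfIntegers ℚ) ∈ v.asIdeal → r''.IsCrystallineOrdinaryAt p v) ∧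
      (∀ᶠ v in Filter.cofinite, r''.IsUnramifiedAt v) ∧
      r'.IsResiduallyCongruent r'' ∧
      (∃ π'' : Literature.NumberTheory.Automorphic.CuspidalAutomorphicRepData 6 ℚ hcpt,
        (∃ T : Literature.NumberTheory.Automorphic.InfinityType ℚ 6,
          π''.1.HasInfinityType T ∧ T.IsLAlgebraic ∧ T.IsRegular) ∧
        ∀ᶠ v in Filter.cofinite, SatakeFrobCompatibleAt ι π''.1 r'' v) := by
  sorry

/-- **STUB 3 — singular-weight ordinary automorphy lifting from a REGULAR automorphic congruence**
(the BCGP-shaped theorem one rung down). For `E, τ, p` (odd, split in `E`), `ι`, `hcpt`, and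
`r, r'' : Γ_ℚ → GL₆(ℚ̄_p)`: `r` exactly orthogonal, odd sector, K3-ordinary `(1,4,1)` at `p`, unramified
a.e., residually absolutely irreducible on `Γ_{E(ζ_p)}`; `r''` exactly orthogonal, odd sector,
crystalline-ordinary with distinct exponents at `p`, unramified a.e., `r ≡ r''` residually, `r''`
Satake-matching a.e. a cuspidal `π''` with L-algebraic regular infinity type ⟹ `r` Satake-matches a.e.
an L-algebraic cuspidal `π` of `GL₆(𝔸_ℚ)`. Route of proof: Hida family through `π''` on
`GSpin(V₀)/SO(V₀)`, Calegari–Geraghty/BCGP patching of the ordinary higher-Hida complex (amplitude ≤ 2,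
defect `ℓ₀ = 2`) with the orthogonal Hecke algebra at inert primes, `R^ord_{r̄} ↠ T^ord` nilpotent
kernel, classicity of the ordinary specialisation at the K3 weight, Arthur's transfer `SO(V₀) → GL₆/ℚ`
with unramified matching at split and inert places. Size XL — the hardest stub. Why it might fail:
defect 2 (vs BCGP's 1), adequacy only for `p ≥ 10` while the crux allows `p ∈ {3,5,7}`, the `(1,4,1)`
flag need not be `p`-distinguished, no integral higher Hida theory for this fourfold.
[cite: BoxerEtAl2021, Thm 8.4.1] [cite: CalegariGeraghty2017, Thm 1.1] [cite: Thorne2012, Thm 7.1]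
[cite: Arthur2013, Thm 1.5.2] [cite: Taibi2018] -/
theorem stub_liftFromRegularCompanion :
    ∀ (E : Type) [Field E] [NumberField E] [IsGalois ℚ E] [NumberField.IsTotallyComplex E],
      Module.finrank ℚ E = 2 →
    ∀ (τ : Field.absoluteGaloisGroup ℚ),
      τ ∉ Set.range (Literature.NumberTheory.GaloisRepresentations.absGaloisRestrict ℚ E) →
    ∀ (p : ℕ) [Fact p.Prime], p ≠ 2 →
    (∃ w w' : IsDedekindDomain.HeightOneSpectrum (NumberField.RingOfIntegers E), w ≠ w' ∧
      ((p : ℕ) : NumberField.RingOfIntegers E) ∈ w.asIdeal ∧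
      ((p : ℕ) : NumberField.RingOfIntegers E) ∈ w'.asIdeal) →
    ∀ (ι : PadicAlgCl p ≃+* ℂ)
      (hcpt : Literature.NumberTheory.Automorphic.isCompact_glFiniteIntegralLevel 6 ℚ)
      (r r'' : Literature.NumberTheory.GaloisRepresentations.FramedGaloisRep ℚ (PadicAlgCl p) 6),
      (∃ J : Matrix (Fin 6) (Fin 6) (PadicAlgCl p), J.IsSymm ∧ IsUnit J ∧
        ∀ σ, (r σ).valᵀ * J * (r σ).val = J) →
      ((∀ σ, (r.restrictField E).det σ = 1) ∧ r.det τ = -1) →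
      (∀ (v : IsDedekindDomain.HeightOneSpectrum (NumberField.RingOfIntegers ℚ)),
        ((p : ℕ) : NumberField.RingOfIntegers ℚ) ∈ v.asIdeal →
        ∃ (g : GL (Fin 6) (PadicAlgCl p))
          (U : OpenSubgroup (Field.absoluteGaloisGroup (v.adicCompletion ℚ))),
          (∀ σ (i j : Fin 6), ((1 ≤ i.val ∧ j.val = 0) ∨ (i.val = 5 ∧ j.val ≤ 4)) →
            (g * r.toLocal v σ * g⁻¹).val i j = 0) ∧
          (∀ σ ∈ Literature.NumberTheory.GaloisRepresentations.absInertia (v.adicCompletion ℚ),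
            σ ∈ U →
            (∀ i j : Fin 6, (1 ≤ i.val ∧ i.val ≤ 4 ∧ 1 ≤ j.val ∧ j.val ≤ 4) →
              (g * r.toLocal v σ * g⁻¹).val i j = if i = j then 1 else 0) ∧
            (g * r.toLocal v σ * g⁻¹).val 0 0 = algebraMap ℚ_[p] (PadicAlgCl p)
              ((Literature.NumberTheory.GaloisRepresentations.GaloisRep.cyclotomicCharacter
                (v.adicCompletion ℚ) p σ : ℤ_[p]ˣ) : ℤ_[p]) ∧
            (g * r.toLocal v σ * g⁻¹).val 0 0 * (g * r.toLocal v σ * g⁻¹).val 5 5 = 1)) →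
      (∀ᶠ v in Filter.cofinite, r.IsUnramifiedAt v) →
      (r.restrictField (CyclotomicField p E)).HasAbsolutelyIrreducibleReduction →
      (∃ J : Matrix (Fin 6) (Fin 6) (PadicAlgCl p), J.IsSymm ∧ IsUnit J ∧
        ∀ σ, (r'' σ).valᵀ * J * (r'' σ).val = J) →
      ((∀ σ, (r''.restrictField E).det σ = 1) ∧ r''.det τ = -1) →
      (∀ (v : IsDedekindDomain.HeightOneSpectrum (NumberField.RingOfIntegers ℚ)),
        ((p : ℕ) : NumberField.RingOfIntegers ℚ) ∈ v.asIdeal → r''.IsCrystallineOrdinaryAt p v) →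
      (∀ᶠ v in Filter.cofinite, r''.IsUnramifiedAt v) →
      r.IsResiduallyCongruent r'' →
      (∃ π'' : Literature.NumberTheory.Automorphic.CuspidalAutomorphicRepData 6 ℚ hcpt,
        (∃ T : Literature.NumberTheory.Automorphic.InfinityType ℚ 6,
          π''.1.HasInfinityType T ∧ T.IsLAlgebraic ∧ T.IsRegular) ∧
        ∀ᶠ v in Filter.cofinite, SatakeFrobCompatibleAt ι π''.1 r'' v) →
      ∃ π : Literature.NumberTheory.Automorphic.CuspidalAutomorphicRepData 6 ℚ hcpt,
        π.1.IsLAlgebraic ∧ ∀ᶠ v in Filter.cofinite, SatakeFrobCompatibleAt ι π.1 r v := by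
  sorry

/-! ## 2. The stub statements as named `Prop`s (literally their types) -/

namespace _Goal

/-- The statement of `stub_residualBignessTransport`, as a named `Prop` (literally its type). [folklore] -/
def stub_residualBignessTransport : Prop :=
  type_of% @Summit.Langlands.Langlands.Cruxes.OrthogonalK3Lifting.Birth.stub_residualBignessTransport

/-- The statement of `stub_regularOrdinaryCompanion`, as a named `Prop` (literally its type). [folklore] -/
def stub_regularOrdinaryCompanion : Prop :=
  type_of% @Summit.Langlands.Langlands.Cruxes.OrthogonalK3Lifting.Birth.stub_regularOrdinaryCompanion

/-- The statement of `stub_liftFromRegularCompanion`, as a named `Prop` (literally its type). [folklore] -/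
def stub_liftFromRegularCompanion : Prop :=
  type_of% @Summit.Langlands.Langlands.Cruxes.OrthogonalK3Lifting.Birth.stub_liftFromRegularCompanion

end _Goal

/-! ## 3. The composition (kernel-checked, no `sorry`): TRANSPORT → COMPANION → LIFT → the crux by name -/

/-- **`OrthogonalK3Lifting` from the three stubs.** Given the crux's data: transport the big residual
image from `r` to `r'` along `r ≡ r'` over `E(ζ_p)` (`stub_residualBignessTransport`); take a regular
ordinary automorphic companion `(r'', π'')` of the automorphic K3 point `(r', π')`
(`stub_regularOrdinaryCompanion`); chain `r ≡ r' ≡ r''` (`FramedRep.IsResiduallyCongruent.trans`, `ℚ̄_p`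
ultrametric); lift (`stub_liftFromRegularCompanion`). The hypotheses are, by name, the statements of the
three stubs; the conclusion is the route decl
`Summit.Langlands.Langlands.Theses.K3SpinSixteen.OrthogonalK3Lifting`. [folklore] -/
theorem OrthogonalK3Lifting_of (h₁ : _Goal.stub_residualBignessTransport)
    (h₂ : _Goal.stub_regularOrdinaryCompanion) (h₃ : _Goal.stub_liftFromRegularCompanion) :
    Summit.Langlands.Langlands.Theses.K3SpinSixteen.OrthogonalK3Lifting := by
  -- the stub statements, as the Π-types they literally are
  have hT : type_of% @stub_residualBignessTransport := h₁
  have hC : type_of% @stub_regularOrdinaryCompanion := h₂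
  have hL : type_of% @stub_liftFromRegularCompanion := h₃
  intro E _ _ _ _ hE2 τ hτ p _ hp2 hsplit ι hcpt r r' hJ hodd hord hunr hbig hJ' hodd' hord' hunr' hcong hπ'
  -- big residual image passes from `r` to `r'` along the congruence
  have hbig' : (r'.restrictField (CyclotomicField p E)).HasAbsolutelyIrreducibleReduction :=
    hT p 6 ℚ (CyclotomicField p E) r r' hcong hbig
  -- a regular ordinary automorphic companion of the automorphic K3 point `(r', π')`
  obtain ⟨r'', hJ'', hodd'', hreg'', hunr'', hcong', hπ''⟩ :=
    hC E hE2 τ hτ p hp2 hsplit ι hcpt r' hJ' hodd' hord' hunr' hbig' hπ'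
  -- lift `r` from the regular companion through `r ≡ r' ≡ r''`
  exact hL E hE2 τ hτ p hp2 hsplit ι hcpt r r'' hJ hodd hord hunr hbig hJ'' hodd'' hreg'' hunr''
    (hcong.trans hcong') hπ''

/-- By-name sanity check (an `example`, not a declaration of the file): the three stubs feed the
composition as they stand. -/
example : Summit.Langlands.Langlands.Theses.K3SpinSixteen.OrthogonalK3Lifting :=
  OrthogonalK3Lifting_of stub_residualBignessTransport stub_regularOrdinaryCompanion
    stub_liftFromRegularCompanion

end Summit.Langlands.Langlands.Cruxes.OrthogonalK3Lifting.Birth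

end
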